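import Literature.Analysis.FluidPDE.CheskidovShvydkoyRegularProofs
import Literature.Analysis.FluidPDE.LerayLocalRegularH1Proofs
import HarnessLib

/-!
# On an interval of `H¹`-regularity a Leray–Hopf solution is classical, and bounded on compact
# sub-intervals

Analysis/FluidPDE **proofs file** (theorems only: no definitions, no named facts, no `sorry`).
Leray's *époques de régularité* in the tree's vocabulary (Leray 1934, §§19–24, §33;
Robinson–Rodrigo–Sadowski 2016, §8.1 and Thm. 8.14; Cheskidov–Shvydkoy 2010, pp. 5–6 "intervals
of regularity"): let `u` be a Leray–Hopf weak solution on `ℝ³ × [0, T)` (`ν > 0`) which is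
`H¹`-regular (`IsH1RegularOn`) on an open interval `(α, β) ⊆ (0, T)`.

* `IsClassicalNSSolutionOn.exists_glue_Ioc_right` — gluing classical solutions on nested time
  sets `(a, b_n]` with right ends exhausting `(a, β)` (companion of the accepted
  `IsClassicalNSSolutionOn.exists_glue_Ioc`, which glues at the left end).
* `exists_classical_Ioo_of_isH1RegularOn` — from every good restarting time `s ∈ (α, β)` the
  solution has a classical representative `(V, P)` on the open time set `(s, β)`:
  `u(t) = V(t)` a.e. for every `t ∈ (s, β)` (the proved Ladyzhenskaya–Prodi–Serrin theorem
  `ladyzhenskaya_prodi_serrin_holds` through `classical_of_isH1RegularOn` on the horizons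
  `b_n ↑ β`, glued).
* `exists_ae_bound_Icc_of_isH1RegularOn` — on every compact `[a, b] ⊂ (α, β)` the solution is
  essentially bounded: `‖u(t, x)‖ ≤ M` for a.e. `x`, `t ∈ [a, b]` (Leray's regular solutions from
  the `H¹` data `u(σ)` at good times `σ`, `leray_local_regular_H1_holds`, have all derivatives
  bounded away from `σ` and coincide with `u(σ + ·)` by the proved weak–strong uniqueness
  `serrin_weak_strong_uniqueness_holds`; a uniform `H¹` bound on `[a', b]` makes the lifespan
  uniform, and compactness of `[a, b]` finishes).
* `forall_norm_le_of_ae_bound` — an a.e. bound passes to every point of a continuous slice.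

These are the generic ingredients turning a blow-up criterion proved for classical solutions
bounded on earlier slabs into a statement about Leray–Hopf weak solutions (used for Lei–Zhang
2011, Thm. 1.4, on the path of `LeiZhang2011_regularity_bmoStream`).

## References

* J. Leray, Acta Math. 63 (1934), §§19–24, §33. [Leray1934]
* J. C. Robinson, J. L. Rodrigo, W. Sadowski, *The Three-Dimensional Navier–Stokes Equations*,
  CUP (2016), §8.1, Thms. 6.10, 8.14, 8.17. [RobinsonRodrigoSadowski2016]
* A. Cheskidov, R. Shvydkoy, Arch. Ration. Mech. Anal. 195 (2010) = arXiv:0708.3067, pp. 5–6.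
  [CheskidovShvydkoy2010]
-/

noncomputable section

open MeasureTheory Set Function Filter Topology
open scoped ENNReal NNReal

namespace Literature.Analysis.FluidPDE

/-! ### Gluing classical solutions on nested time sets `(a, b_n]`, `b_n ↑ β` -/

section GlueRight

variable {E : Type*} [NormedAddCommGroup E] [InnerProductSpace ℝ E] [FiniteDimensional ℝ E]
variable {ν : ℝ}

/-- The one-sided time derivative within `(a, b]` at an interior time `t < b` is the time
derivative within any larger time set `(a, β)`, `b ≤ β`... in fact within any set containing
`(a, b)` and agreeing with the field there: derivatives within sets that coincide near `t`
coincide (Mathlib `derivWithin_inter`). [folklore] -/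
theorem timeDerivWithin_Ioo_eq_Ioc_of_eqOn {X F : Type*} [NormedAddCommGroup F] [NormedSpace ℝ F]
    {a b β t : ℝ} {w₁ w₂ : ℝ → X → F} (hbβ : b ≤ β) (hat : a < t) (htb : t < b)
    (heq : ∀ τ ∈ Ioo a b, w₁ τ = w₂ τ) (x : X) :
    timeDerivWithin (Ioo a β) w₁ t x = timeDerivWithin (Ioc a b) w₂ t x := by
  simp only [timeDerivWithin_apply]
  have h1 : Ioo a β ∩ Iio b = Ioo a b := by
    ext τ
    simp only [mem_inter_iff, mem_Ioo, mem_Iio]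
    constructor
    · rintro ⟨⟨h1, -⟩, h3⟩; exact ⟨h1, h3⟩
    · rintro ⟨h1, h2⟩; exact ⟨⟨h1, h2.trans_le hbβ⟩, h2⟩
  have h2 : Ioc a b ∩ Iio b = Ioo a b := by
    ext τ
    simp only [mem_inter_iff, mem_Ioc, mem_Ioo, mem_Iio]
    constructor
    · rintro ⟨⟨h1, -⟩, h3⟩; exact ⟨h1, h3⟩
    · rintro ⟨h1, h2⟩; exact ⟨⟨h1, h2.le⟩, h2⟩
  have e1 : derivWithin (fun s => w₁ s x) (Ioo a β) t =
      derivWithin (fun s => w₁ s x) (Ioo a b) t := by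
    rw [← derivWithin_inter (Iio_mem_nhds htb), h1]
  have e2 : derivWithin (fun s => w₂ s x) (Ioc a b) t =
      derivWithin (fun s => w₂ s x) (Ioo a b) t := by
    rw [← derivWithin_inter (Iio_mem_nhds htb), h2]
  rw [e1, e2]
  exact derivWithin_congr (fun τ hτ => congrFun (heq τ hτ) x) (congrFun (heq t ⟨hat, htb⟩) x)

/-- **Gluing classical solutions on nested time sets with a common left end.** Let `(V n, P n)`
be classical solutions (same `ν`, same force) on the time sets `(a, b n]`, whose right ends
exhaust `(a, β)` (every `t < β` has `t < b n` for some `n`, and `b n ≤ β`), and whose velocities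
agree on the common part `(a, min (b m) (b n)]`. Then there is a classical solution `(v, p)` on
`(a, β)` with `v = V n` on `(a, b n)` for every `n` (velocity `V n (t)` and normalised pressure
`P n (t) − P n (t, 0)` for any `n` with `t < b n`; smoothness is local, and the time derivative
within `(a, β)` at `t < b n` is that within `(a, b n]`, `timeDerivWithin_Ioo_eq_Ioc_of_eqOn`).
Companion of `IsClassicalNSSolutionOn.exists_glue_Ioc`. [folklore] -/
theorem IsClassicalNSSolutionOn.exists_glue_Ioc_right {a β : ℝ} {f : ℝ → E → E} {b : ℕ → ℝ}
    {V : ℕ → ℝ → E → E} {P : ℕ → ℝ → E → ℝ} (hbβ : ∀ n, b n ≤ β)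
    (hb : ∀ t, t < β → ∃ n, t < b n)
    (hV : ∀ n, IsClassicalNSSolutionOn (Ioc a (b n)) ν f (V n) (P n))
    (hagree : ∀ m n, ∀ t ∈ Ioc a (min (b m) (b n)), V m t = V n t) :
    ∃ (v : ℝ → E → E) (p : ℝ → E → ℝ), IsClassicalNSSolutionOn (Ioo a β) ν f v p ∧
      ∀ n, ∀ t ∈ Ioo a (b n), v t = V n t := by
  classical
  -- the index of a piece containing `t` in its interior
  set N : ℝ → ℕ := fun t => if h : ∃ n, t < b n then Nat.find h else 0 with hN_def
  have hN : ∀ t, t < β → t < b (N t) := by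
    intro t ht
    have h := hb t ht
    simp only [hN_def, dif_pos h]
    exact Nat.find_spec h
  set v : ℝ → E → E := fun t => V (N t) t with hv_def
  set p : ℝ → E → ℝ := fun t x => P (N t) t x - P (N t) t 0 with hp_def
  have hvn : ∀ n, ∀ t ∈ Ioo a (b n), v t = V n t := by
    intro n t ht
    have htβ : t < β := ht.2.trans_le (hbβ n)
    exact hagree (N t) n t ⟨ht.1, le_min (hN t htβ).le ht.2.le⟩
  -- time derivatives within the pieces agree at interior times
  have hdtn : ∀ m n, ∀ t ∈ Ioo a (min (b m) (b n)), ∀ x,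
      timeDerivWithin (Ioc a (b m)) (V m) t x = timeDerivWithin (Ioc a (b n)) (V n) t x := by
    intro m n t ht x
    have htm : t < b m := ht.2.trans_le (min_le_left _ _)
    have htn : t < b n := ht.2.trans_le (min_le_right _ _)
    have h1 : timeDerivWithin (Ioo a β) (V m) t x = timeDerivWithin (Ioc a (b m)) (V m) t x :=
      timeDerivWithin_Ioo_eq_Ioc_of_eqOn (hbβ m) ht.1 htm (fun τ _ => rfl) x
    have h2 : timeDerivWithin (Ioo a β) (V m) t x = timeDerivWithin (Ioc a (b n)) (V n) t x := by
      have hmin : min (b m) (b n) ≤ β := (min_le_left _ _).trans (hbβ m)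
      have h3 : timeDerivWithin (Ioo a β) (V m) t x =
          timeDerivWithin (Ioc a (min (b m) (b n))) (V n) t x :=
        timeDerivWithin_Ioo_eq_Ioc_of_eqOn hmin ht.1 ht.2
          (fun τ hτ => hagree m n τ ⟨hτ.1, hτ.2.le⟩) x
      have h4 : timeDerivWithin (Ioo a β) (V n) t x =
          timeDerivWithin (Ioc a (min (b m) (b n))) (V n) t x :=
        timeDerivWithin_Ioo_eq_Ioc_of_eqOn hmin ht.1 ht.2 (fun τ _ => rfl) x
      have h5 : timeDerivWithin (Ioo a β) (V n) t x = timeDerivWithin (Ioc a (b n)) (V n) t x :=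
        timeDerivWithin_Ioo_eq_Ioc_of_eqOn (hbβ n) ht.1 htn (fun τ _ => rfl) x
      rw [h3, ← h4, h5]
    rw [← h1, h2]
  have hpn : ∀ n, ∀ t ∈ Ioo a (b n), ∀ x, p t x = P n t x - P n t 0 := by
    intro n t ht x
    have htβ : t < β := ht.2.trans_le (hbβ n)
    have hm : t ∈ Ioc a (b (N t)) := ⟨ht.1, (hN t htβ).le⟩
    exact (hV (N t)).pressure_sub_apply_zero_eq_of_timeDerivWithin_eq (hV n) hm ⟨ht.1, ht.2.le⟩
      (hagree (N t) n t ⟨ht.1, le_min (hN t htβ).le ht.2.le⟩)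
      (hdtn (N t) n t ⟨ht.1, lt_min (hN t htβ) ht.2⟩) x
  -- the time derivative within `(a, β)` is that within the piece
  have hdt0 : ∀ n, ∀ t ∈ Ioo a (b n), ∀ x,
      timeDerivWithin (Ioo a β) v t x = timeDerivWithin (Ioc a (b n)) (V n) t x := fun n t ht x =>
    timeDerivWithin_Ioo_eq_Ioc_of_eqOn (hbβ n) ht.1 ht.2 (hvn n) x
  -- relative openness of the pieces
  have hpiece : ∀ n, Ioo a β ×ˢ (univ : Set E) ∩ Iio (b n) ×ˢ univ = Ioo a (b n) ×ˢ univ := by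
    intro n
    ext ⟨t, x⟩
    simp only [mem_inter_iff, mem_prod, mem_Ioo, mem_univ, and_true, mem_Iio]
    constructor
    · rintro ⟨⟨h1, -⟩, h3⟩; exact ⟨h1, h3⟩
    · rintro ⟨h1, h2⟩; exact ⟨⟨h1, h2.trans_le (hbβ n)⟩, h2⟩
  have hsmooth : ∀ (w : ℝ → E → ℝ) (W : ℕ → ℝ → E → ℝ),
      (∀ n, IsSmoothSpaceTimeOn (Ioc a (b n)) (W n)) →
      (∀ n, ∀ t ∈ Ioo a (b n), ∀ x, w t x = W n t x) → IsSmoothSpaceTimeOn (Ioo a β) w := by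
    intro w W hW hwW
    refine contDiffOn_of_locally_contDiffOn fun z hz => ?_
    obtain ⟨n, hn⟩ := hb z.1 hz.1.2
    refine ⟨Iio (b n) ×ˢ univ, isOpen_Iio.prod isOpen_univ, ⟨hn, mem_univ _⟩, ?_⟩
    rw [hpiece n]
    exact ((hW n).mono Ioo_subset_Ioc_self).congr fun z' hz' => hwW n z'.1 hz'.1 z'.2
  have hsmoothE : ∀ (w : ℝ → E → E) (W : ℕ → ℝ → E → E),
      (∀ n, IsSmoothSpaceTimeOn (Ioc a (b n)) (W n)) →
      (∀ n, ∀ t ∈ Ioo a (b n), w t = W n t) → IsSmoothSpaceTimeOn (Ioo a β) w := by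
    intro w W hW hwW
    refine contDiffOn_of_locally_contDiffOn fun z hz => ?_
    obtain ⟨n, hn⟩ := hb z.1 hz.1.2
    refine ⟨Iio (b n) ×ˢ univ, isOpen_Iio.prod isOpen_univ, ⟨hn, mem_univ _⟩, ?_⟩
    rw [hpiece n]
    exact ((hW n).mono Ioo_subset_Ioc_self).congr fun z' hz' => by
      show w z'.1 z'.2 = W n z'.1 z'.2
      rw [hwW n z'.1 hz'.1]
  refine ⟨v, p, ⟨?_, ?_, ?_, ?_⟩, hvn⟩
  · exact hsmoothE v V (fun n => (hV n).smooth_velocity) hvn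
  · exact hsmooth p (fun n t x => P n t x - P n t 0)
      (fun n => (hV n).smooth_pressure.sub_apply_zero) hpn
  · intro t ht x
    obtain ⟨n, hn⟩ := hb t ht.2
    have htn : t ∈ Ioo a (b n) := ⟨ht.1, hn⟩
    have hgrad : gradient (p t) x = gradient (P n t) x := by
      rw [show p t = fun y => P n t y - P n t 0 from funext (hpn n t htn), gradient_sub_const]
    rw [hdt0 n t htn x, hvn n t htn, hgrad]
    exact (hV n).momentum t ⟨htn.1, htn.2.le⟩ x
  · intro t ht
    obtain ⟨n, hn⟩ := hb t ht.2
    rw [hvn n t ⟨ht.1, hn⟩]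
    exact (hV n).divFree t ⟨ht.1, hn.le⟩

end GlueRight

/-! ### A.e. bounds and continuous slices -/

/-- An a.e. bound on the norm of a continuous field on `ℝ³` holds everywhere (the exceptional
set is open and null, hence empty). [folklore] -/
theorem forall_norm_le_of_ae_bound {F : Type*} [NormedAddCommGroup F]
    {g : EuclideanSpace ℝ (Fin 3) → F} (hg : Continuous g) {M : ℝ}
    (h : ∀ᵐ x ∂volume, ‖g x‖ ≤ M) : ∀ x, ‖g x‖ ≤ M := by
  have hopen : IsOpen {x | M < ‖g x‖} := isOpen_lt continuous_const hg.norm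
  have hnull : volume {x | M < ‖g x‖} = 0 := by
    rw [ae_iff] at h
    simpa only [not_le] using h
  have hempty := (hopen.measure_eq_zero_iff volume).1 hnull
  intro x
  by_contra hx
  have : x ∈ {x | M < ‖g x‖} := not_le.1 hx
  rw [hempty] at this
  exact this

/-! ### The classical representative on an interval of regularity -/

section Classical

variable {ν T : ℝ} {u₀ : EuclideanSpace ℝ (Fin 3) → EuclideanSpace ℝ (Fin 3)}
  {u : ℝ → EuclideanSpace ℝ (Fin 3) → EuclideanSpace ℝ (Fin 3)}

/-- **On an interval of `H¹`-regularity a Leray–Hopf solution is classical from every good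
time on.** Let `u` be Leray–Hopf on `ℝ³ × [0, T)` (`ν > 0`), `H¹`-regular on `(α, β)`,
`β ≤ T`, and let `s ∈ (α, β)` be a good restarting time (`u(· + s)` Leray–Hopf from `u(s)`).
Then there is a classical solution `(V, P)` on the open time set `(s, β)` with `u(t) = V(t)`
a.e. for every `t ∈ (s, β)` (Robinson–Rodrigo–Sadowski 2016, Thm. 8.17 and §8.1: on the horizons
`b_n = β − (β − s)/(n + 2)` the translate is `H¹`-regular up to the final time, so
`classical_of_isH1RegularOn` — the proved Ladyzhenskaya–Prodi–Serrin theorem in `L^∞_t L⁶_x` —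
represents it classically on `(s, b_n]`; continuous representatives of the same slices agree, and
the pieces glue, `IsClassicalNSSolutionOn.exists_glue_Ioc_right`). [cite: RobinsonRodrigoSadowski2016, Thm. 8.17 and §8.1] -/
theorem exists_classical_Ioo_of_isH1RegularOn (hν : 0 < ν)
    {α β : ℝ} (hβ : β ≤ T) (hreg : IsH1RegularOn (Ioo α β) u)
    {s : ℝ} (hs : s ∈ Ioo α β) (hLHs : IsLerayHopfOn (T - s) ν 0 (u s) (fun t => u (t + s))) :
    ∃ (V : ℝ → EuclideanSpace ℝ (Fin 3) → EuclideanSpace ℝ (Fin 3))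
      (P : ℝ → EuclideanSpace ℝ (Fin 3) → ℝ),
      IsClassicalNSSolutionOn (Ioo s β) ν 0 V P ∧ ∀ t ∈ Ioo s β, u t =ᵐ[volume] V t := by
  -- the horizons
  set b : ℕ → ℝ := fun n => β - (β - s) / ((n : ℝ) + 2) with hbdef
  have hsβ : 0 < β - s := sub_pos.2 hs.2
  have hbs : ∀ n, s < b n := fun n => by
    have h2 : (2 : ℝ) ≤ (n : ℝ) + 2 := by linarith [n.cast_nonneg (α := ℝ)]
    have : (β - s) / ((n : ℝ) + 2) < β - s := by
      rw [div_lt_iff₀ (by positivity)]; nlinarith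
    simp only [hbdef]; linarith
  have hbβ : ∀ n, b n ≤ β := fun n => by
    simp only [hbdef]
    linarith [div_nonneg hsβ.le (by positivity : (0 : ℝ) ≤ (n : ℝ) + 2)]
  have hbβ' : ∀ n, b n < β := fun n => by
    simp only [hbdef]
    linarith [div_pos hsβ (by positivity : (0 : ℝ) < (n : ℝ) + 2)]
  have hb : ∀ t, t < β → ∃ n, t < b n := by
    intro t ht
    obtain ⟨n, hn⟩ := exists_nat_gt ((β - s) / (β - t))
    refine ⟨n, ?_⟩
    have hβt : 0 < β - t := sub_pos.2 ht
    have h1 : (β - s) / ((n : ℝ) + 2) < β - t := by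
      rw [div_lt_iff₀ (by positivity)]
      rw [div_lt_iff₀ hβt] at hn
      nlinarith
    simp only [hbdef]; linarith
  -- the pieces
  have hpiece : ∀ n, ∃ (V : ℝ → EuclideanSpace ℝ (Fin 3) → EuclideanSpace ℝ (Fin 3))
      (P : ℝ → EuclideanSpace ℝ (Fin 3) → ℝ),
      IsClassicalNSSolutionOn (Ioc s (b n)) ν 0 V P ∧ ∀ t ∈ Ioc s (b n), u t =ᵐ[volume] V t := by
    intro n
    have hTn : 0 < b n - s := sub_pos.2 (hbs n)
    have hLHn : IsLerayHopfOn (b n - s) ν 0 (u s) (fun t => u (t + s)) :=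
      hLHs.of_le (by linarith [hbβ n])
    have hregn : IsH1RegularOn (Ioc 0 (b n - s)) (fun t => u (t + s)) := by
      have hmaps : MapsTo (fun t : ℝ => t + s) (Ioc 0 (b n - s)) (Ioo α β) := fun t ht =>
        ⟨by linarith [ht.1, hs.1], by linarith [ht.2, hbβ' n]⟩
      exact ⟨fun t ht => hreg.1 (t + s) (hmaps ht),
        hreg.2.comp (continuousOn_id.add continuousOn_const) hmaps⟩
    obtain ⟨v, p, hcl, hae⟩ :=
      classical_of_isH1RegularOn ladyzhenskaya_prodi_serrin_holds hν hTn hLHn hregn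
    -- translate back by `-s`
    have hcl' := hcl.comp_add_right (-s)
    have hsub : Ioc s (b n) ⊆ (· + -s) ⁻¹' Ioc 0 (b n - s) := fun t ht =>
      ⟨by simp only; linarith [ht.1], by simp only; linarith [ht.2]⟩
    have h0 : (fun t => (0 : ℝ → EuclideanSpace ℝ (Fin 3) → EuclideanSpace ℝ (Fin 3)) (t + -s)) =
        0 := rfl
    rw [h0] at hcl'
    refine ⟨fun t => v (t + -s), fun t => p (t + -s), hcl'.mono hsub (uniqueDiffOn_Ioc s (b n)),
      fun t ht => ?_⟩
    have h1 := hae (t + -s) ⟨by linarith [ht.1], by linarith [ht.2]⟩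
    simp only [neg_add_cancel_right] at h1
    exact h1
  choose V P hV hrep using hpiece
  -- agreement on overlaps
  have hagree : ∀ m n, ∀ t ∈ Ioc s (min (b m) (b n)), V m t = V n t := by
    intro m n t ht
    have htm : t ∈ Ioc s (b m) := ⟨ht.1, ht.2.trans (min_le_left _ _)⟩
    have htn : t ∈ Ioc s (b n) := ⟨ht.1, ht.2.trans (min_le_right _ _)⟩
    exact eq_of_ae_eq_of_continuous ((hV m).contDiff_velocity htm).continuous
      ((hV n).contDiff_velocity htn).continuous ((hrep m t htm).symm.trans (hrep n t htn))
  obtain ⟨v, p, hvp, hvn⟩ := IsClassicalNSSolutionOn.exists_glue_Ioc_right hbβ hb hV hagree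
  refine ⟨v, p, hvp, fun t ht => ?_⟩
  obtain ⟨n, hn⟩ := hb t ht.2
  rw [hvn n t ⟨ht.1, hn⟩]
  exact hrep n t ⟨ht.1, hn.le⟩

/-- **On compact sub-intervals of an interval of `H¹`-regularity a Leray–Hopf solution is
essentially bounded.** Let `u` be Leray–Hopf on `ℝ³ × [0, T)` (`ν > 0`), `H¹`-regular on
`(α, β)`, `0 ≤ α`, `β ≤ T`, and `α < a`, `b < β`. Then `‖u(t, x)‖ ≤ M` for a.e. `x`, for every
`t ∈ [a, b]`. Proof (Leray 1934, §§19–23; Ożański–Pooley 2018, Thm. 6.30 with Cor. 6.16;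
Robinson–Rodrigo–Sadowski 2016, Thms. 6.15, 6.10): with `A ≥ ‖u(τ)‖²_{H¹}` on `[a', b]`,
`a' = (α + a)/2`, and the lifespan `d = min (c ν³/(A² + 1)) (β − b)`, each `t ∈ [a, b]` lies
strictly inside the window `(σ, σ + d)` of Leray's regular solution from the datum `u(σ)` at a
good time `σ ∈ (max a' (t − d/2), t)`; that solution has all derivatives bounded on
`[σ + (t − σ)/2, σ + d] × ℝ³` (`leray_local_regular_H1_holds`) and equals `u(σ + ·)` a.e.
(`serrin_weak_strong_uniqueness_holds` in `L^∞_t L⁶_x`); finitely many windows cover `[a, b]`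
(`IsCompact.induction_on`). [cite: OzanskiPooley2018, Thm. 6.30 and Cor. 6.16] -/
theorem exists_ae_bound_Icc_of_isH1RegularOn (hν : 0 < ν) (hLH : IsLerayHopfOn T ν 0 u₀ u)
    {α β : ℝ} (hα : 0 ≤ α) (hβ : β ≤ T) (hreg : IsH1RegularOn (Ioo α β) u)
    {a b : ℝ} (ha : α < a) (hb : b < β) :
    ∃ M : ℝ, ∀ t ∈ Icc a b, ∀ᵐ x ∂volume, ‖u t x‖ ≤ M := by
  obtain ⟨c, hc, hpack⟩ := leray_local_regular_H1_holds
  -- a uniform `H¹` bound on `[a', b]`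
  set a' : ℝ := (α + a) / 2 with ha'
  have hαa' : α < a' := by rw [ha']; linarith
  have ha'a : a' < a := by rw [ha']; linarith
  obtain ⟨Mtop, hMtop, hH1⟩ := hreg.exists_forall_le isCompact_Icc
    (fun t ht => ⟨hαa'.trans_le ht.1, ht.2.trans_lt hb⟩ : Icc a' b ⊆ Ioo α β)
  set A : ℝ := Mtop.toReal + 1 with hAdef
  have hA0 : 0 ≤ A := by positivity
  have hAM : Mtop ≤ ENNReal.ofReal A :=
    calc Mtop = ENNReal.ofReal Mtop.toReal := (ENNReal.ofReal_toReal hMtop.ne).symm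
      _ ≤ ENNReal.ofReal A := ENNReal.ofReal_le_ofReal (by rw [hAdef]; linarith)
  -- the uniform lifespan
  set d : ℝ := min (c * ν ^ 3 / (A ^ 2 + 1)) (β - b) with hddef
  have hd : 0 < d := lt_min (by positivity) (sub_pos.2 hb)
  have hAd : A ^ 2 * d ≤ c * ν ^ 3 := by
    have h1 : d ≤ c * ν ^ 3 / (A ^ 2 + 1) := min_le_left _ _
    have h2 : A ^ 2 * (c * ν ^ 3 / (A ^ 2 + 1)) ≤ c * ν ^ 3 := by
      rw [mul_div_assoc', div_le_iff₀ (by positivity)]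
      nlinarith [sq_nonneg A, mul_pos hc (pow_pos hν 3)]
    nlinarith [mul_le_mul_of_nonneg_left h1 (sq_nonneg A)]
  have hdβ : d ≤ β - b := min_le_right _ _
  -- the local statement near each `t ∈ [a, b]`
  have hloc : ∀ t ∈ Icc a b, ∃ U ∈ 𝓝[Icc a b] t, ∃ M : ℝ, ∀ τ ∈ U, ∀ᵐ x ∂volume, ‖u τ x‖ ≤ M := by
    intro t ht
    -- a good time `σ ∈ (max a' (t - d/2), t)`
    have hlo : max a' (t - d / 2) < t := max_lt (ha'a.trans_le ht.1) (by linarith)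
    have hlo0 : 0 ≤ max a' (t - d / 2) := (hα.trans hαa'.le).trans (le_max_left _ _)
    have htT : t ≤ T := (ht.2.trans hb.le).trans hβ
    obtain ⟨σ, hσ, hLHσ⟩ := hLH.exists_isLerayHopfOn_restart_Ioo hν.le hlo0 hlo htT
    have ha'σ : a' < σ := (le_max_left _ _).trans_lt hσ.1
    have htσ : t - d / 2 < σ := (le_max_right _ _).trans_lt hσ.1
    have hσT : σ + d ≤ T := by linarith [ht.2, hσ.2]
    have hσpos : 0 < σ := (hα.trans_lt hαa').trans ha'σ
    -- Leray's regular solution from `u σ`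
    have hu2 : MemLp (u σ) 2 volume := hLH.memLp σ ⟨hσpos.le, by linarith⟩
    have hdiv : IsWeaklyDivFree (u σ) := hLHσ.isWeaklyDivFree_datum (by linarith)
    have hAσ : eWeakGradL2Sq (u σ) ≤ ENNReal.ofReal A :=
      (le_add_self.trans (hH1 σ ⟨ha'σ.le, hσ.2.le.trans ht.2⟩)).trans hAM
    obtain ⟨v, p, hv, -, hvreg, -, hcl⟩ := hpack hν hd hu2 hdiv hA0 hAσ hAd
    -- weak–strong uniqueness on `(0, d]`
    have hLHσ' : IsLerayHopfOn d ν 0 (u σ) (fun τ => u (τ + σ)) := hLHσ.of_le (by linarith)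
    have hS : MemLqLp ∞ 6 v (Ioo 0 d) :=
      memLqLp_top_six_of_isH1RegularOn_Icc hvreg fun τ hτ => hv.memLp τ hτ
    have hqr : 2 / (∞ : ℝ≥0∞) + 3 / 6 ≤ 1 := by
      rw [ENNReal.div_top, zero_add]
      exact ENNReal.div_le_of_le_mul (by norm_num)
    have hae : ∀ τ ∈ Ioc 0 d, u (τ + σ) =ᵐ[volume] v τ := fun τ hτ =>
      serrin_weak_strong_uniqueness_holds hν hd hv hu2 (q := ∞) (r := 6) (by norm_num) hqr hS
        hLHσ' τ hτ
    -- the window `[σ + δ, σ + d]`, `δ = (t - σ)/2`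
    set δ : ℝ := (t - σ) / 2 with hδdef
    have hδ : 0 < δ := by rw [hδdef]; linarith [hσ.2]
    have hδd : δ ≤ d := by rw [hδdef]; linarith
    obtain ⟨-, -, hsup, -⟩ := hcl δ hδ hδd
    obtain ⟨C, hC⟩ := hsup 0
    have hw1 : σ + δ < t := by rw [hδdef]; linarith [hσ.2]
    have hw2 : t < σ + d := by linarith [htσ, hd]
    refine ⟨Icc a b ∩ Ioo (σ + δ) (σ + d), inter_mem_nhdsWithin _ (Ioo_mem_nhds hw1 hw2), C,
      fun τ hτ => ?_⟩
    have hτw : τ - σ ∈ Ioc 0 d := ⟨by linarith [hτ.2.1], by linarith [hτ.2.2]⟩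
    have h1 := hae (τ - σ) hτw
    rw [sub_add_cancel] at h1
    filter_upwards [h1] with x hx
    rw [hx]
    have h2 := hC (τ - σ) ⟨by linarith [hτ.2.1], hτw.2⟩ x
    rwa [norm_iteratedFDeriv_zero] at h2
  -- compactness of `[a, b]`
  refine isCompact_Icc.induction_on (p := fun S => ∃ M : ℝ, ∀ τ ∈ S, ∀ᵐ x ∂volume, ‖u τ x‖ ≤ M)
    ⟨0, fun τ hτ => absurd hτ (notMem_empty τ)⟩
    (fun S₁ S₂ hS ⟨M, hM⟩ => ⟨M, fun τ hτ => hM τ (hS hτ)⟩)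
    (fun S₁ S₂ ⟨M₁, hM₁⟩ ⟨M₂, hM₂⟩ => ⟨max M₁ M₂, fun τ hτ => ?_⟩) hloc
  rcases hτ with hτ | hτ
  · exact (hM₁ τ hτ).mono fun x hx => hx.trans (le_max_left _ _)
  · exact (hM₂ τ hτ).mono fun x hx => hx.trans (le_max_right _ _)

end Classical

end Literature.Analysis.FluidPDE
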